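import Mathlib
import HarnessLib
import Summits.NavierStokesRegularity.NavierStokesRegularity.Theorems.UnthreadedRigidityDoorUnthreadedRigidityMixedPairQuadLawAlternative

/-!
# Route `UnthreadedRigidityDoor`, item `UnthreadedRigidity` (W2, stmt-NavierStokesRegularity-27585) — LINE g11-2 «MIXED PAIR»:
# THE QUAD LAW ON THE LINKED FAMILY, CERTIFIED, and O2b′ reduced to ONE explicit-field slice statement (file 2 of 2)

Prover file (engine-1 g73; `--supports stmt-NavierStokesRegularity-27585 --as helper`; route-independent imports).  File 1 is
`…MixedPairQuadLawAlternative` (★ `quadLaw_alternative`: linked analytic admissible profiles with `W₁·D ≡ 0` are null/null/Helmholtz-linked).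

* §3 `polarised_identity_alg`, ★ `polarised_quadLaw_identity` — THE QUAD LAW, CERTIFIED (CARD §5 «`V″`, `V²` terms cancel»): on the linked
  family, for `r > 0`, `r·H₁²·P₂ = 6·W₁·D`, where `P₂ = H₁·K₂[K₂H₂] − 3H₂·K₁[K₁H₁] − 2K₁K₂` is the POLARISED ORDER-ONE AMPLITUDE (the radial
  coefficient `Λ(H₁,K₂H₂) + Λ(K₁H₁,H₂)` that Δ-polarising O1₂ `CoZonal.twoShellSliceOrderOneIdentity_holds` assigns to the quadratic part of the
  second jet, up to the factor `−2`), `W₁ = K₁′H₁ − K₁H₁′`, `D = H₁H₂ + r(H₁H₂′ − H₁′H₂)`: a `linear_combination` of the linkage relation and its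
  first two derivatives (the jets of `Kᵢ` stay opaque; only `rK₁ = rH₁″ + 4H₁′`, `rK₂ = rH₂″ + 6H₂′` are used).  Hence
  ★ `quadLaw_alternative_polarised` — the alternative from `P₂ ≡ 0` (isolated zeros of `H₁` + file 1).
* §4 ★ `equatorialDichotomy_primed_of_sliceLaw` — O2b′ (verbatim the section hypothesis `hEq` of `…MixedPairWindowReduction`) from the
  «EQUATORIAL SLICE LAW» (explicit binders, no new `def`): for linked equatorial non-coaxial admissible pair data with profiles analytic on
  `(0,∞)`, a smooth divergence-free slice, a smooth decaying pressure slice solving `Δp₀ = −div((u₀·∇)u₀)`, `fluxJetTwo u₀ p₀ x₀ ≡ 0 ⇒ P₂ ≡ 0`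
  on `(0,∞)`.  The jet dictionary (`iteratedDerivWithin_two_threadingFlux_Ici_eq_fluxJetTwo`, `laplacian_pressure_eq_Ico`, ns-crc-p1 g8) is the
  discharged M-part, exactly as in `ThreadingJets.orderTwoVirialIdentity_of_dichotomy`; `equatorialDichotomy_of_sliceLaw : slice law →
  EquatorialDichotomy`.  NET: both g11-2 rungs ⇐ {O2a′, EQUATORIAL SLICE LAW, S-H′} (`…MixedPairWindowReduction`).

HONEST LABEL: algebra of radial profiles and rung bookkeeping for SPECIAL two-shell data; the equatorial slice law (the channel-2 computation
of the pair's second jet), O2a′ and S-H′(c<0) remain OPEN; `UnthreadedRigidity` (27585), W2 and NS regularity remain OPEN; nothing here is a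
statement about Navier–Stokes regularity.  0 kit.
-/

noncomputable section

-- the summit and its single sub-problem share the name (CONVENTIONS §1), as in every Theorems file
set_option linter.dupNamespace false

namespace Summit.NavierStokesRegularity.NavierStokesRegularity.Theorems.UnthreadedRigidity.MixedPair

open scoped Topology InnerProductSpace
open Filter Set MeasureTheory Function
open Literature.Analysis.FluidPDE
open Summit.NavierStokesRegularity.NavierStokesRegularity.Theorems.UnthreadedRigidity.ProfileHorn (E3 threadingFlux IsSliceAxisymmetric)
open Summit.NavierStokesRegularity.NavierStokesRegularity.Theorems.UnthreadedRigidity.VirialHorn (e det3 vortAmpL VirialAdmissible sepShellL)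
open Summit.NavierStokesRegularity.NavierStokesRegularity.Theorems.UnthreadedRigidity.ThreadingJets (fluxJetTwo analyticOnNhd_vortAmpL
  iteratedDerivWithin_two_threadingFlux_Ici_eq_fluxJetTwo laplacian_pressure_eq_Ico)

/-! ### §3 The quad law on the linked family, certified: `r·H₁²·P₂ = 6·W₁·D` -/

section Polarised

variable {H₁ H₂ : ℝ → ℝ}

/-- THE ALGEBRA OF THE QUAD LAW (CARD §5 «`V″`, `V²` terms cancel»): with `kᵢ, kᵢ′, kᵢ″` the jets of `Kᵢ = vortAmpL lᵢ Hᵢ`, the linkage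
relation `Λ = H₁K₂ − 3H₂K₁ = 0` and its first two derivatives give `H₁²·Π = 6·W₁·D`, `Π = H₁(rK₂″ + 6K₂′) − 3H₂(rK₁″ + 4K₁′) − 2rK₁K₂`
(`= r·P₂`).  A `linear_combination`; the jets `kᵢ` enter only through `rK₁ = rH₁″ + 4H₁′`, `rK₂ = rH₂″ + 6H₂′`. [folklore] -/
theorem polarised_identity_alg {r h0 h1 h2 g0 g1 g2 k1 k1' k1'' k2 k2' k2'' : ℝ}
    (hK₁ : r * k1 = r * h2 + 4 * h1) (hK₂ : r * k2 = r * g2 + 6 * g1)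
    (hΛ : h0 * k2 - 3 * (g0 * k1) = 0)
    (hΛ' : h1 * k2 + h0 * k2' - 3 * (g1 * k1 + g0 * k1') = 0)
    (hΛ'' : h2 * k2 + 2 * h1 * k2' + h0 * k2'' - 3 * (g2 * k1 + 2 * g1 * k1' + g0 * k1'') = 0) :
    h0 ^ 2 * (h0 * (r * k2'' + 6 * k2') - 3 * g0 * (r * k1'' + 4 * k1') - 2 * r * k1 * k2) =
      6 * (k1' * h0 - k1 * h1) * (h0 * g0 + r * (h0 * g1 - h1 * g0)) := by
  have hΛ''r : r * h0 * k2'' + 2 * r * h1 * k2' - 6 * r * g1 * k1' - 3 * r * g0 * k1'' - 2 * r * k1 * k2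
      - 4 * h1 * k2 + 18 * g1 * k1 = 0 := by
    linear_combination r * hΛ'' + k2 * hK₁ - 3 * k1 * hK₂
  linear_combination (2 * r * h1 ^ 2 - 2 * h0 * h1) * hΛ + (6 * h0 ^ 2 - 2 * r * h0 * h1) * hΛ' + h0 ^ 2 * hΛ''r

/-- ★ «THE QUAD LAW ON THE LINKED FAMILY» (CARD §3/§5, certified): for `H₁, H₂` analytic on `(0,∞)` and LINKED, at every `r > 0`
`r·H₁(r)²·P₂(r) = 6·W₁(r)·D(r)`, where `P₂ = H₁·K₂[K₂H₂] − 3H₂·K₁[K₁H₁] − 2K₁K₂` is the POLARISED ORDER-ONE AMPLITUDE (`Kₗ[·] = vortAmpL l`;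
the radial coefficient `Λ(H₁,K₂H₂) + Λ(K₁H₁,H₂)` of the Δ-polarised first jet, up to the factor `−2`), `W₁ = K₁′H₁ − K₁H₁′` and
`D = H₁H₂ + r(H₁H₂′ − H₁′H₂)`; i.e. `P₂ = (6/r)·V′·(H₁H₂ + r(H₁H₂′ − H₁′H₂))` with `V = K₁/H₁` off the zeros of `H₁`. [folklore] -/
theorem polarised_quadLaw_identity (hA₁ : AnalyticOnNhd ℝ H₁ (Ioi 0)) (hA₂ : AnalyticOnNhd ℝ H₂ (Ioi 0)) (hlink : IsLinked H₁ H₂)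
    {r : ℝ} (hr : 0 < r) :
    r * H₁ r ^ 2 * (H₁ r * vortAmpL 2 (vortAmpL 2 H₂) r - 3 * H₂ r * vortAmpL 1 (vortAmpL 1 H₁) r
        - 2 * vortAmpL 1 H₁ r * vortAmpL 2 H₂ r) =
      6 * (deriv (vortAmpL 1 H₁) r * H₁ r - vortAmpL 1 H₁ r * deriv H₁ r) *
        (H₁ r * H₂ r + r * (H₁ r * deriv H₂ r - deriv H₁ r * H₂ r)) := by
  have hr0 : r ≠ 0 := hr.ne'
  have hK₁a : AnalyticOnNhd ℝ (vortAmpL 1 H₁) (Ioi 0) := analyticOnNhd_vortAmpL hA₁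
  have hK₂a : AnalyticOnNhd ℝ (vortAmpL 2 H₂) (Ioi 0) := analyticOnNhd_vortAmpL hA₂
  -- derivatives on `(0,∞)`
  have d₁ : ∀ s : ℝ, 0 < s → HasDerivAt H₁ (deriv H₁ s) s := fun s hs => (hA₁ s hs).differentiableAt.hasDerivAt
  have d₁' : ∀ s : ℝ, 0 < s → HasDerivAt (deriv H₁) (deriv (deriv H₁) s) s := fun s hs =>
    (hA₁.deriv s hs).differentiableAt.hasDerivAt
  have d₂ : ∀ s : ℝ, 0 < s → HasDerivAt H₂ (deriv H₂ s) s := fun s hs => (hA₂ s hs).differentiableAt.hasDerivAt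
  have d₂' : ∀ s : ℝ, 0 < s → HasDerivAt (deriv H₂) (deriv (deriv H₂) s) s := fun s hs =>
    (hA₂.deriv s hs).differentiableAt.hasDerivAt
  have e₁ : ∀ s : ℝ, 0 < s → HasDerivAt (vortAmpL 1 H₁) (deriv (vortAmpL 1 H₁) s) s := fun s hs =>
    (hK₁a s hs).differentiableAt.hasDerivAt
  have e₁' : ∀ s : ℝ, 0 < s → HasDerivAt (deriv (vortAmpL 1 H₁)) (deriv (deriv (vortAmpL 1 H₁)) s) s :=
    fun s hs => (hK₁a.deriv s hs).differentiableAt.hasDerivAt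
  have e₂ : ∀ s : ℝ, 0 < s → HasDerivAt (vortAmpL 2 H₂) (deriv (vortAmpL 2 H₂) s) s := fun s hs =>
    (hK₂a s hs).differentiableAt.hasDerivAt
  have e₂' : ∀ s : ℝ, 0 < s → HasDerivAt (deriv (vortAmpL 2 H₂)) (deriv (deriv (vortAmpL 2 H₂)) s) s :=
    fun s hs => (hK₂a.deriv s hs).differentiableAt.hasDerivAt
  -- the jets of `K₁`, `K₂` at `r`
  have hK₁ : r * vortAmpL 1 H₁ r = r * deriv (deriv H₁) r + 4 * deriv H₁ r := by
    simp only [vortAmpL]; push_cast; field_simp; ring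
  have hK₂ : r * vortAmpL 2 H₂ r = r * deriv (deriv H₂) r + 6 * deriv H₂ r := by
    simp only [vortAmpL]; push_cast; field_simp; ring
  -- the linkage relation and its first two derivatives at `r`
  have hΛ0 : ∀ s : ℝ, 0 < s → H₁ s * vortAmpL 2 H₂ s - 3 * (H₂ s * vortAmpL 1 H₁ s) = (fun _ : ℝ => (0 : ℝ)) s :=
    fun s hs => by simp only [hlink s hs, sub_self]
  have hΛ : H₁ r * vortAmpL 2 H₂ r - 3 * (H₂ r * vortAmpL 1 H₁ r) = 0 := hΛ0 r hr
  have hΛd : ∀ s : ℝ, 0 < s → HasDerivAt (fun t : ℝ => H₁ t * vortAmpL 2 H₂ t - 3 * (H₂ t * vortAmpL 1 H₁ t))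
      (deriv H₁ s * vortAmpL 2 H₂ s + H₁ s * deriv (vortAmpL 2 H₂) s
        - 3 * (deriv H₂ s * vortAmpL 1 H₁ s + H₂ s * deriv (vortAmpL 1 H₁) s)) s := fun s hs =>
    ((d₁ s hs).mul (e₂ s hs)).sub (((d₂ s hs).mul (e₁ s hs)).const_mul 3)
  have hΛ'0 : ∀ s : ℝ, 0 < s → deriv H₁ s * vortAmpL 2 H₂ s + H₁ s * deriv (vortAmpL 2 H₂) s
      - 3 * (deriv H₂ s * vortAmpL 1 H₁ s + H₂ s * deriv (vortAmpL 1 H₁) s) = (fun _ : ℝ => (0 : ℝ)) s := fun s hs => by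
    rw [← (hΛd s hs).deriv, deriv_eq_of_forall_pos hΛ0 hs, deriv_const]
  have hΛ' := hΛ'0 r hr
  have hΛdd : HasDerivAt (fun t : ℝ => deriv H₁ t * vortAmpL 2 H₂ t + H₁ t * deriv (vortAmpL 2 H₂) t
      - 3 * (deriv H₂ t * vortAmpL 1 H₁ t + H₂ t * deriv (vortAmpL 1 H₁) t))
      (deriv (deriv H₁) r * vortAmpL 2 H₂ r + deriv H₁ r * deriv (vortAmpL 2 H₂) r
        + (deriv H₁ r * deriv (vortAmpL 2 H₂) r + H₁ r * deriv (deriv (vortAmpL 2 H₂)) r)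
        - 3 * (deriv (deriv H₂) r * vortAmpL 1 H₁ r + deriv H₂ r * deriv (vortAmpL 1 H₁) r
          + (deriv H₂ r * deriv (vortAmpL 1 H₁) r + H₂ r * deriv (deriv (vortAmpL 1 H₁)) r))) r :=
    (((d₁' r hr).mul (e₂ r hr)).add ((d₁ r hr).mul (e₂' r hr))).sub
      ((((d₂' r hr).mul (e₁ r hr)).add ((d₂ r hr).mul (e₁' r hr))).const_mul 3)
  have hΛ'' : deriv (deriv H₁) r * vortAmpL 2 H₂ r + 2 * deriv H₁ r * deriv (vortAmpL 2 H₂) r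
      + H₁ r * deriv (deriv (vortAmpL 2 H₂)) r
      - 3 * (deriv (deriv H₂) r * vortAmpL 1 H₁ r + 2 * deriv H₂ r * deriv (vortAmpL 1 H₁) r
        + H₂ r * deriv (deriv (vortAmpL 1 H₁)) r) = 0 := by
    have h := hΛdd.deriv
    rw [deriv_eq_of_forall_pos hΛ'0 hr, deriv_const] at h
    linear_combination -h
  -- unfold the OUTER `vortAmpL`s only, clear the denominators, and use the algebra
  have u₁ : vortAmpL 1 (vortAmpL 1 H₁) r =
      deriv (deriv (vortAmpL 1 H₁)) r + 2 * (((1 : ℕ) : ℝ) + 1) / r * deriv (vortAmpL 1 H₁) r := rfl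
  have u₂ : vortAmpL 2 (vortAmpL 2 H₂) r =
      deriv (deriv (vortAmpL 2 H₂)) r + 2 * (((2 : ℕ) : ℝ) + 1) / r * deriv (vortAmpL 2 H₂) r := rfl
  rw [u₁, u₂]
  push_cast
  have hP : r * H₁ r ^ 2 * (H₁ r * (deriv (deriv (vortAmpL 2 H₂)) r + 2 * (2 + 1) / r * deriv (vortAmpL 2 H₂) r)
      - 3 * H₂ r * (deriv (deriv (vortAmpL 1 H₁)) r + 2 * (1 + 1) / r * deriv (vortAmpL 1 H₁) r)
      - 2 * vortAmpL 1 H₁ r * vortAmpL 2 H₂ r) =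
      H₁ r ^ 2 * (H₁ r * (r * deriv (deriv (vortAmpL 2 H₂)) r + 6 * deriv (vortAmpL 2 H₂) r)
        - 3 * H₂ r * (r * deriv (deriv (vortAmpL 1 H₁)) r + 4 * deriv (vortAmpL 1 H₁) r)
        - 2 * r * vortAmpL 1 H₁ r * vortAmpL 2 H₂ r) := by
    field_simp
    ring
  rw [hP]
  exact polarised_identity_alg hK₁ hK₂ hΛ hΛ' hΛ''

/-- ★ «QUAD-LAW ALTERNATIVE, POLARISED CURRENCY»: the alternative from `P₂ ≡ 0` on `(0,∞)` (the form the channel-2 computation of the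
pair's second jet delivers) — `P₂ ≡ 0` and `H₁ ≢ 0` make the analytic function `W₁·D` vanish off the (isolated) zeros of `H₁`, hence
everywhere on `(0,∞)`. [folklore] -/
theorem quadLaw_alternative_polarised (hV₁ : VirialAdmissible 1 H₁) (hV₂ : VirialAdmissible 2 H₂)
    (hA₁ : AnalyticOnNhd ℝ H₁ (Ioi 0)) (hA₂ : AnalyticOnNhd ℝ H₂ (Ioi 0)) (hlink : IsLinked H₁ H₂)
    (hP : ∀ r : ℝ, 0 < r →
      H₁ r * vortAmpL 2 (vortAmpL 2 H₂) r - 3 * H₂ r * vortAmpL 1 (vortAmpL 1 H₁) r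
        - 2 * vortAmpL 1 H₁ r * vortAmpL 2 H₂ r = 0) :
    IsNullProfile H₁ ∨ IsNullProfile H₂ ∨ IsHelmholtzLinked H₁ H₂ := by
  by_cases h1z : ∀ r : ℝ, 0 < r → H₁ r = 0
  · exact Or.inl (isNullProfile_of_forall_pos hV₁ h1z)
  push Not at h1z
  obtain ⟨r₀, hr₀, h0⟩ := h1z
  have hK₁a : AnalyticOnNhd ℝ (vortAmpL 1 H₁) (Ioi 0) := analyticOnNhd_vortAmpL hA₁
  have hWDa : AnalyticOnNhd ℝ (fun r => (deriv (vortAmpL 1 H₁) r * H₁ r - vortAmpL 1 H₁ r * deriv H₁ r) *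
      (H₁ r * H₂ r + r * (H₁ r * deriv H₂ r - deriv H₁ r * H₂ r))) (Ioi 0) := fun r hr =>
    (((hK₁a.deriv r hr).mul (hA₁ r hr)).sub ((hK₁a r hr).mul (hA₁.deriv r hr))).mul
      (((hA₁ r hr).mul (hA₂ r hr)).add
        (analyticAt_id.mul (((hA₁ r hr).mul (hA₂.deriv r hr)).sub ((hA₁.deriv r hr).mul (hA₂ r hr)))))
  have hev : (fun r => (deriv (vortAmpL 1 H₁) r * H₁ r - vortAmpL 1 H₁ r * deriv H₁ r) *
      (H₁ r * H₂ r + r * (H₁ r * deriv H₂ r - deriv H₁ r * H₂ r))) =ᶠ[𝓝 r₀] 0 := by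
    filter_upwards [(hA₁ r₀ hr₀).continuousAt.eventually_ne h0, Ioi_mem_nhds hr₀] with s hs hs0
    have hid := polarised_quadLaw_identity hA₁ hA₂ hlink hs0
    rw [hP s hs0, mul_zero] at hid
    have h6 : (deriv (vortAmpL 1 H₁) s * H₁ s - vortAmpL 1 H₁ s * deriv H₁ s) *
        (H₁ s * H₂ s + s * (H₁ s * deriv H₂ s - deriv H₁ s * H₂ s)) = 0 := by linear_combination -hid / 6
    simpa using h6
  exact quadLaw_alternative hV₁ hV₂ hA₁ hA₂ hlink (eqOn_zero_of_eventuallyEq_zero hWDa hr₀ hev)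

end Polarised

/-! ### §4 O2b′ from the equatorial slice law -/

section SliceLaw

open scoped Laplacian

/-- ★ **O2b′ «EQUATORIAL DICHOTOMY» (pressure decay at `t₀` only — verbatim the section hypothesis `hEq` of `…MixedPairWindowReduction`)
FROM THE «EQUATORIAL SLICE LAW»**, the one remaining explicit-field statement of O2b (explicit binders, no new `def`): for LINKED,
EQUATORIAL, NON-COAXIAL admissible pair data with profiles analytic on `(0,∞)`, a smooth divergence-free slice `u₀ = pairShell H₁ H₂ a Q x₀`,
a smooth pressure slice `p₀` solving `Δp₀ = −div((u₀·∇)u₀)` and decaying at infinity, order-two silence `fluxJetTwo u₀ p₀ x₀ ≡ 0` forces the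
POLARISED QUAD LAW `P₂ ≡ 0` on `(0,∞)` (CARD §3/§5: channel `V₂` of `c₂` = the quad law alone for `Qa = 0`).  The M-part — the one-sided
second jet of the classical solution at `t₀` IS `fluxJetTwo (u t₀) (p t₀) x₀` (`iteratedDerivWithin_two_threadingFlux_Ici_eq_fluxJetTwo`), the
slice is smooth and divergence free, `p t₀` is smooth and solves the Poisson equation (`laplacian_pressure_eq_Ico`) — is discharged here exactly
as in `ThreadingJets.orderTwoVirialIdentity_of_dichotomy`; the alternative is `quadLaw_alternative_polarised`. -/
theorem equatorialDichotomy_primed_of_sliceLaw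
    (hSL : ∀ (H₁ H₂ : ℝ → ℝ) (a : E3) (Q : E3 →L[ℝ] E3) (x₀ : E3) (p₀ : E3 → ℝ),
      PairAdmissible H₁ H₂ a Q → IsEquatorial a Q → ¬ IsCoaxial a Q → IsLinked H₁ H₂ →
      AnalyticOnNhd ℝ H₁ (Set.Ioi 0) → AnalyticOnNhd ℝ H₂ (Set.Ioi 0) →
      ContDiff ℝ (⊤ : ℕ∞) (pairShell H₁ H₂ a Q x₀) → VectorCalculus.IsDivFree (pairShell H₁ H₂ a Q x₀) →
      ContDiff ℝ (⊤ : ℕ∞) p₀ →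
      (∀ x : E3, (Δ p₀) x = -VectorCalculus.divergence (convect (pairShell H₁ H₂ a Q x₀) (pairShell H₁ H₂ a Q x₀)) x) →
      Tendsto p₀ (cocompact E3) (𝓝 0) →
      (∀ x : E3, fluxJetTwo (pairShell H₁ H₂ a Q x₀) p₀ x₀ x = 0) →
      ∀ r : ℝ, 0 < r → H₁ r * vortAmpL 2 (vortAmpL 2 H₂) r - 3 * H₂ r * vortAmpL 1 (vortAmpL 1 H₁) r
        - 2 * vortAmpL 1 H₁ r * vortAmpL 2 H₂ r = 0) :
    ∀ (t₀ T : ℝ) (u : ℝ → E3 → E3) (p : ℝ → E3 → ℝ) (x₀ a : E3) (Q : E3 →L[ℝ] E3) (H₁ H₂ : ℝ → ℝ),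
      t₀ < T → IsClassicalNSSolutionOn (Set.Ico t₀ T) 1 0 u p → Tendsto (p t₀) (cocompact E3) (𝓝 0) →
      (∀ x : E3, ContDiffWithinAt ℝ 2 (fun t => threadingFlux u x₀ t x) (Set.Ici t₀) t₀) →
      PairAdmissible H₁ H₂ a Q → IsEquatorial a Q → ¬ IsCoaxial a Q → u t₀ = pairShell H₁ H₂ a Q x₀ →
      AnalyticOnNhd ℝ H₁ (Set.Ioi 0) → AnalyticOnNhd ℝ H₂ (Set.Ioi 0) → IsLinked H₁ H₂ →
      (∀ x : E3, iteratedDerivWithin 2 (fun t => threadingFlux u x₀ t x) (Set.Ici t₀) t₀ = 0) →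
      IsNullProfile H₁ ∨ IsNullProfile H₂ ∨ IsHelmholtzLinked H₁ H₂ := by
  intro t₀ T u p x₀ a Q H₁ H₂ hT h hp _hcd hadm heq hnco hu0 hA1 hA2 hl hjet
  have ht₀ : t₀ ∈ Ico t₀ T := ⟨le_rfl, hT⟩
  have hsm : ContDiff ℝ (⊤ : ℕ∞) (pairShell H₁ H₂ a Q x₀) := by rw [← hu0]; exact h.contDiff_velocity ht₀
  have hdiv : VectorCalculus.IsDivFree (pairShell H₁ H₂ a Q x₀) := by rw [← hu0]; exact h.divFree t₀ ht₀
  have hps : ContDiff ℝ (⊤ : ℕ∞) (p t₀) := h.contDiff_pressure ht₀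
  have hpoi : ∀ x : E3, (Δ (p t₀)) x =
      -VectorCalculus.divergence (convect (pairShell H₁ H₂ a Q x₀) (pairShell H₁ H₂ a Q x₀)) x := by
    intro x
    rw [← hu0]
    exact laplacian_pressure_eq_Ico h hT ht₀ x
  have hj : ∀ x : E3, fluxJetTwo (pairShell H₁ H₂ a Q x₀) (p t₀) x₀ x = 0 := by
    intro x
    rw [← hu0, ← iteratedDerivWithin_two_threadingFlux_Ici_eq_fluxJetTwo h hT]
    exact hjet x
  exact quadLaw_alternative_polarised hadm.2.2.1 hadm.2.2.2 hA1 hA2 hl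
    (hSL H₁ H₂ a Q x₀ (p t₀) hadm heq hnco hl hA1 hA2 hsm hdiv hps hpoi hp hj)

/-- Hence O2b `EquatorialDichotomy` (decay on the whole interval) from the equatorial slice law (`equatorialDichotomy_of_primed`). -/
theorem equatorialDichotomy_of_sliceLaw
    (hSL : ∀ (H₁ H₂ : ℝ → ℝ) (a : E3) (Q : E3 →L[ℝ] E3) (x₀ : E3) (p₀ : E3 → ℝ),
      PairAdmissible H₁ H₂ a Q → IsEquatorial a Q → ¬ IsCoaxial a Q → IsLinked H₁ H₂ →
      AnalyticOnNhd ℝ H₁ (Set.Ioi 0) → AnalyticOnNhd ℝ H₂ (Set.Ioi 0) →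
      ContDiff ℝ (⊤ : ℕ∞) (pairShell H₁ H₂ a Q x₀) → VectorCalculus.IsDivFree (pairShell H₁ H₂ a Q x₀) →
      ContDiff ℝ (⊤ : ℕ∞) p₀ →
      (∀ x : E3, (Δ p₀) x = -VectorCalculus.divergence (convect (pairShell H₁ H₂ a Q x₀) (pairShell H₁ H₂ a Q x₀)) x) →
      Tendsto p₀ (cocompact E3) (𝓝 0) →
      (∀ x : E3, fluxJetTwo (pairShell H₁ H₂ a Q x₀) p₀ x₀ x = 0) →
      ∀ r : ℝ, 0 < r → H₁ r * vortAmpL 2 (vortAmpL 2 H₂) r - 3 * H₂ r * vortAmpL 1 (vortAmpL 1 H₁) r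
        - 2 * vortAmpL 1 H₁ r * vortAmpL 2 H₂ r = 0) :
    EquatorialDichotomy :=
  equatorialDichotomy_of_primed (equatorialDichotomy_primed_of_sliceLaw hSL)

end SliceLaw

end Summit.NavierStokesRegularity.NavierStokesRegularity.Theorems.UnthreadedRigidity.MixedPair

end
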